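import Mathlib
import Literature.Analysis.FluidPDE.VorticityCalculus
import Summits.NavierStokesRegularity.NavierStokesRegularity.Theorems.ThreadingFluxHorizonTowerSphereRigidity
import Summits.NavierStokesRegularity.NavierStokesRegularity.Theorems.ThreadingFluxHorizonTowerPoloidalFieldCalculus
import Summits.NavierStokesRegularity.NavierStokesRegularity.Theorems.ThreadingFluxHorizonTowerProfileFormulas
import Summits.NavierStokesRegularity.NavierStokesRegularity.Theorems.ThreadingFluxHorizonTowerFirstLemmas
import HarnessLib

/-!
# Crux `PoloidalLiouville` (stmt-NavierStokesRegularity-1222, W1), crux idea «precession-gap» (ns-idea-15):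
# tools for item (J) `ConicalSteadyEulerRigidity` — cross-product bookkeeping and the RIGIDITY OF IRROTATIONAL SCALE-FREE PROFILES

Support file (`--supports stmt-NavierStokesRegularity-1222`, helper), first of two toward the sketch statement
`Cruxes/PoloidalLiouville/PrecessionSketch.lean` l.235 `ConicalSteadyEulerRigidity` (the second is
`ThreadingFluxPrecessionConicalEulerRigidity`).  Experiment cell `ns-wall-extremal`, width hand ns-wall-eng-4 g4.  0 kit.

* `ConicalEuler.exists_eq_smul_of_cross_eq_zero` — `a × b = 0`, `b ≠ 0` ⇒ `a ∈ ℝ b` (Lagrange's identity);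
  `ConicalEuler.gradient_norm_inv` — `∇(1/r) = −x/r³`.
* `ConicalEuler.laplacian_eq_zero_of_curl_eq_zero` — a field `C²` off `0`, divergence free and irrotational off `0`, is harmonic
  off `0` (`curl curl = ∇div − Δ`, Literature `curl_curl_eq_sum_fderiv_divergence_sub_laplacian`, localised with a
  `ContDiffBump` cut-off as in `ThreadingFluxHorizonTowerSphereRigidity` step 3).
* `ConicalEuler.eq_of_curl_eq_zero` — **rigidity of irrotational scale-free profiles**: a field `C²` off the origin, degree-0
  homogeneous, divergence free and irrotational off `0` is CONSTANT off the origin (each coordinate is harmonic on the connected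
  open set `ℝ³ ∖ {0}` and attains its maximum over the unit sphere at an interior point: strong maximum principle, Literature
  `divForm_strongMaximumPrinciple_of_contDiff`, verbatim the argument of `HorizonTower.SphereRigidity.eq_zero` step 4).

HONEST FRAME: vector calculus / elliptic rigidity about hypothetical scale-free profiles; nothing here bears on `PoloidalLiouville`
(1222) or NS regularity, both OPEN.

## References
* A. J. Majda, A. L. Bertozzi, *Vorticity and Incompressible Flow* (CUP 2002), §1.1 (vector identities), §2.4.1. [MajdaBertozziCUP2002]
* D. Gilbarg, N. S. Trudinger, *Elliptic PDE of Second Order*, Thm 3.5 (strong maximum principle). [GilbargTrudinger2001]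
-/

-- the summit and its single problem share the name (D-0017 nested layout)
set_option linter.dupNamespace false

noncomputable section

namespace Summit.NavierStokesRegularity.NavierStokesRegularity.Theorems.PoloidalLiouville.Precession

open Set Function Filter Topology Metric
open scoped Topology RealInnerProductSpace Laplacian ContDiff
open Literature.Analysis.FluidPDE
open Summit.NavierStokesRegularity.NavierStokesRegularity.Theorems.PoloidalLiouville.HorizonTower (E3)

namespace ConicalEuler

/-! ### Two pieces of linear algebra in `ℝ³` -/

/-- If `a × b = 0` and `b ≠ 0` then `a` is a multiple of `b` (Lagrange's identity `‖a × b‖² = ‖a‖²‖b‖² − ⟪a,b⟫²`). -/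
theorem exists_eq_smul_of_cross_eq_zero {a b : E3} (hb : b ≠ 0) (h : cross a b = 0) : ∃ μ : ℝ, a = μ • b := by
  have hb2 : (0 : ℝ) < ‖b‖ ^ 2 := by positivity
  refine ⟨⟪a, b⟫ / ‖b‖ ^ 2, ?_⟩
  have hL : ‖a‖ ^ 2 * ‖b‖ ^ 2 - ⟪a, b⟫ ^ 2 = 0 := by
    rw [← Tao2016.norm_cross_sq, h, norm_zero, zero_pow two_ne_zero]
  have hsq : ‖a - (⟪a, b⟫ / ‖b‖ ^ 2) • b‖ ^ 2 = 0 := by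
    rw [norm_sub_sq_real, inner_smul_right, norm_smul, mul_pow, Real.norm_eq_abs, sq_abs]
    field_simp
    nlinarith [hL]
  rw [← sub_eq_zero]
  exact norm_eq_zero.mp (pow_eq_zero_iff two_ne_zero |>.mp hsq)

/-- `∇(‖·‖⁻¹)(x) = −‖x‖⁻³ x` off the origin. -/
theorem gradient_norm_inv {x : E3} (hx : x ≠ 0) :
    gradient (fun w : E3 => ‖w‖⁻¹) x = (-(‖x‖⁻¹ * (‖x‖ ^ 2)⁻¹)) • x := by
  have hq : (‖x‖ ^ 2) ≠ 0 := by positivity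
  have hs : Real.sqrt (‖x‖ ^ 2) ≠ 0 := by rw [Real.sqrt_sq (norm_nonneg x)]; exact norm_ne_zero_iff.mpr hx
  have hd : HasDerivAt (fun s : ℝ => (Real.sqrt s)⁻¹) (-(1 / (2 * Real.sqrt (‖x‖ ^ 2))) / Real.sqrt (‖x‖ ^ 2) ^ 2)
      (‖x‖ ^ 2) := (Real.hasDerivAt_sqrt hq).inv hs
  have h := HorizonTower.gradient_comp_norm_sq (g := fun s : ℝ => (Real.sqrt s)⁻¹) (z := x) hd
  have e : (fun w : E3 => (fun s : ℝ => (Real.sqrt s)⁻¹) (‖w‖ ^ 2)) = fun w => ‖w‖⁻¹ :=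
    funext fun w => by simp only [Real.sqrt_sq (norm_nonneg w)]
  rw [e, Real.sqrt_sq (norm_nonneg x)] at h
  rw [h]
  congr 1
  field_simp

/-! ### Irrotational, divergence-free, degree-0 homogeneous fields off the origin are constant -/

variable {U : E3 → E3}

/-- `ΔU = 0` off the origin for a field `C²` off `0` that is divergence free and irrotational off `0`
(`curl curl = ∇div − Δ` applied to a cut-off copy of `U` that is `C²` on all of `ℝ³`). -/
theorem laplacian_eq_zero_of_curl_eq_zero (hU : ContDiffOn ℝ 2 U {0}ᶜ)
    (hdiv : ∀ x : E3, x ≠ 0 → VectorCalculus.divergence U x = 0) (hcurl : ∀ x : E3, x ≠ 0 → curl U x = 0)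
    {x : E3} (hx : x ≠ 0) : (Δ U) x = 0 := by
  have hopen : IsOpen ({0}ᶜ : Set E3) := isOpen_compl_singleton
  have hxpos : 0 < ‖x‖ := norm_pos_iff.mpr hx
  -- a cut-off equal to `1` near `x` and to `0` near the origin
  let χ : ContDiffBump x := ⟨‖x‖ / 4, ‖x‖ / 2, by positivity, by linarith⟩
  set W : E3 → E3 := fun z => χ z • U z with hW
  have hB0 : ∀ y ∈ ball x (‖x‖ / 4), y ≠ 0 := by
    intro y hy h0
    rw [h0, mem_ball, dist_comm, dist_zero_right] at hy
    linarith
  -- `W = U` near every point of the small ball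
  have hWU : ∀ y ∈ ball x (‖x‖ / 4), W =ᶠ[𝓝 y] U := by
    intro y hy
    filter_upwards [isOpen_ball.mem_nhds hy] with z hz
    show χ z • U z = U z
    rw [χ.one_of_mem_closedBall (ball_subset_closedBall hz), one_smul]
  have hcurlW : curl W =ᶠ[𝓝 x] fun _ => (0 : E3) := by
    filter_upwards [isOpen_ball.mem_nhds (mem_ball_self (by positivity : (0:ℝ) < ‖x‖ / 4))] with y hy
    rw [curl_eq_curlCLM, (hWU y hy).fderiv_eq, ← curl_eq_curlCLM]
    exact hcurl y (hB0 y hy)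
  have hdivW : VectorCalculus.divergence W =ᶠ[𝓝 x] fun _ => (0 : ℝ) := by
    filter_upwards [isOpen_ball.mem_nhds (mem_ball_self (by positivity : (0:ℝ) < ‖x‖ / 4))] with y hy
    unfold VectorCalculus.divergence
    rw [(hWU y hy).fderiv_eq]
    exact hdiv y (hB0 y hy)
  -- `W` is `C²` on all of `ℝ³`
  have hWc : ContDiff ℝ 2 W := by
    rw [contDiff_iff_contDiffAt]
    intro z
    by_cases hz : z = 0
    · have hzero : W =ᶠ[𝓝 z] fun _ => (0 : E3) := by
        subst hz
        have h0 : ‖x‖ / 2 < dist (0 : E3) x := by rw [dist_comm, dist_zero_right]; linarith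
        have hcont : Continuous fun y : E3 => dist y x := continuous_id.dist continuous_const
        filter_upwards [hcont.continuousAt.eventually (Ioi_mem_nhds h0)] with y hy
        show χ y • U y = 0
        rw [χ.zero_of_le_dist (le_of_lt hy), zero_smul]
      exact contDiffAt_const.congr_of_eventuallyEq hzero
    · exact (χ.contDiff (n := 2)).contDiffAt.smul ((hU z hz).contDiffAt (hopen.mem_nhds hz))
  -- `curl curl W (x) = 0`, `∇ div W (x) = 0`, hence `ΔW(x) = 0`
  have h1 : curl (curl W) x = 0 := by
    rw [curl_eq_curlCLM, hcurlW.fderiv_eq, fderiv_fun_const, Pi.zero_apply, map_zero]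
  have h2 : fderiv ℝ (VectorCalculus.divergence W) x = 0 := by
    rw [hdivW.fderiv_eq, fderiv_fun_const, Pi.zero_apply]
  have h3 := curl_curl_eq_sum_fderiv_divergence_sub_laplacian hWc x
  rw [h1, h2] at h3
  simp only [zero_apply, zero_smul, Finset.sum_const_zero, zero_sub, zero_eq_neg] at h3
  -- `ΔU(x) = ΔW(x)`
  have h4 := (InnerProductSpace.laplacian_congr_nhds
    (hWU x (mem_ball_self (by positivity : (0:ℝ) < ‖x‖ / 4)))).eq_of_nhds
  rw [← h4, h3]

/-- **Rigidity of irrotational scale-free profiles.**  A field `U : ℝ³ → ℝ³` of class `C²` off the origin, degree-0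
homogeneous, divergence free and irrotational off `0` is CONSTANT off the origin: every coordinate `Uᵢ` is harmonic on
the connected open set `ℝ³ ∖ {0}` and, being degree-0 homogeneous, attains its maximum over the unit sphere — an interior
maximum — so it is constant (strong maximum principle, Literature `divForm_strongMaximumPrinciple_of_contDiff`). -/
theorem eq_of_curl_eq_zero (hU : ContDiffOn ℝ 2 U {0}ᶜ) (hhom : ∀ c : ℝ, 0 < c → ∀ y : E3, U (c • y) = U y)
    (hdiv : ∀ x : E3, x ≠ 0 → VectorCalculus.divergence U x = 0) (hcurl : ∀ x : E3, x ≠ 0 → curl U x = 0)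
    {x z : E3} (hx : x ≠ 0) (hz : z ≠ 0) : U z = U x := by
  have hopen : IsOpen ({0}ᶜ : Set E3) := isOpen_compl_singleton
  have hrank : 1 < Module.rank ℝ E3 := by
    rw [← Module.finrank_eq_rank]
    norm_cast
    simp
  have hconn : IsPreconnected ({0}ᶜ : Set E3) :=
    (isConnected_compl_singleton_of_one_lt_rank hrank 0).isPreconnected
  ext i
  -- the coordinate `u = Uᵢ`
  set u : E3 → ℝ := fun y => U y i with hu_def
  have hueq : u = (EuclideanSpace.proj i : E3 →L[ℝ] ℝ) ∘ U := by funext y; rfl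
  have hu : ContDiffOn ℝ 2 u {0}ᶜ := by
    rw [hueq]; exact (EuclideanSpace.proj i : E3 →L[ℝ] ℝ).contDiff.comp_contDiffOn hU
  -- `u` is harmonic off the origin
  have hΔu : ∀ y : E3, y ≠ 0 → (Δ u) y = 0 := by
    intro y hy
    have hUy : ContDiffAt ℝ 2 U y := (hU y hy).contDiffAt (hopen.mem_nhds hy)
    rw [hueq, hUy.laplacian_CLM_comp_left, Function.comp_apply, laplacian_eq_zero_of_curl_eq_zero hU hdiv hcurl hy,
      map_zero]
  -- a maximiser on the unit sphere is an interior maximiser on `ℝ³ ∖ {0}`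
  obtain ⟨x₁, hx₁S, hmax₁⟩ : ∃ x₁ ∈ sphere (0 : E3) 1, IsMaxOn u (sphere (0 : E3) 1) x₁ := by
    refine (isCompact_sphere (0 : E3) 1).exists_isMaxOn ⟨‖x‖⁻¹ • x, ?_⟩ ?_
    · rw [mem_sphere_zero_iff_norm, norm_smul, norm_inv, norm_norm, inv_mul_cancel₀ (norm_ne_zero_iff.mpr hx)]
    · refine (hu.continuousOn.mono ?_)
      intro y hy h0
      rw [mem_sphere_zero_iff_norm] at hy
      rw [h0, norm_zero] at hy
      exact zero_ne_one hy
  have hx₁ : x₁ ≠ 0 := by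
    intro h0; rw [h0, mem_sphere_zero_iff_norm, norm_zero] at hx₁S; exact zero_ne_one hx₁S
  have hmax : ∀ y ∈ ({0}ᶜ : Set E3), u y ≤ u x₁ := by
    intro y hy
    have hy0 : y ≠ 0 := hy
    have hny : 0 < ‖y‖ := norm_pos_iff.mpr hy0
    have hmem : ‖y‖⁻¹ • y ∈ sphere (0 : E3) 1 := by
      rw [mem_sphere_zero_iff_norm, norm_smul, norm_inv, norm_norm, inv_mul_cancel₀ hny.ne']
    have hval : u y = u (‖y‖⁻¹ • y) := by
      simp only [hu_def, hhom _ (inv_pos.mpr hny) y]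
    rw [hval]
    exact hmax₁ hmem
  -- strong maximum principle for `Δ` on the connected open set `ℝ³ ∖ {0}`
  have hsmp := Literature.Analysis.PDE.divForm_strongMaximumPrinciple_of_contDiff hopen hconn
    (a := fun _ i j => if i = j then (1 : ℝ) else 0) (u := u) (μ := 1)
    (fun _ _ i j => by by_cases h : i = j <;> simp [h, eq_comm])
    one_pos
    (fun _ _ ξ => by
      have hsum : ∑ i, ∑ j, (if i = j then (1 : ℝ) else 0) * ξ i * ξ j = ∑ i, ξ i * ξ i := by
        refine Finset.sum_congr rfl fun i _ => ?_
        simp only [ite_mul, one_mul, zero_mul, Finset.sum_ite_eq, Finset.mem_univ, if_true]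
      have hnorm : ‖ξ‖ ^ 2 = ∑ i, ξ i * ξ i := by
        rw [EuclideanSpace.norm_sq_eq]
        exact Finset.sum_congr rfl fun i _ => by rw [Real.norm_eq_abs, sq_abs, sq]
      rw [one_mul, hsum, hnorm])
    (fun _ _ => contDiffOn_const) hu
    (by
      intro y hy
      have hy0 : y ≠ 0 := hy
      have hinner : ∀ i', (fun w => ∑ j, (if i' = j then (1 : ℝ) else 0) * fderiv ℝ u w (EuclideanSpace.single j 1))
          = fun w => fderiv ℝ u w (EuclideanSpace.single i' 1) := by
        intro i'; funext w
        simp only [ite_mul, one_mul, zero_mul, Finset.sum_ite_eq, Finset.mem_univ, if_true]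
      simp only [hinner]
      have huy : ContDiffAt ℝ 2 u y := (hu y hy0).contDiffAt (hopen.mem_nhds hy0)
      rw [← HorizonTower.SphereRigidity.laplacian_eq_sum_single huy, hΔu y hy0])
    hx₁ hmax
  have h1 : u z = u x₁ := hsmp z hz
  have h2 : u x = u x₁ := hsmp x hx
  show u z = u x
  rw [h1, h2]

end ConicalEuler

end Summit.NavierStokesRegularity.NavierStokesRegularity.Theorems.PoloidalLiouville.Precession

end
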